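import Summits.SmoothPoincare4.SmoothPoincare4.Theorems.DottedCircleRasmussenDcrGapHelperHandlebodyChartModelHandlesFlowPhase
import Summits.SmoothPoincare4.SmoothPoincare4.Theorems.DottedCircleRasmussenDcrGapHelperHandlebodyChartModelHandlesBaseBall

/-!
# Helper `helper_handlebodyChart_modelHandles` (M3: handle structure of the model dotted handlebody `D_k`)
# of line `mk_friends` for crux `DcrGap` — the cut-off radial flow, part 1: tools
(item stmt-SmoothPoincare4-16128, route route-SmoothPoincare4-DottedCircleRasmussen)

**Registered piece `helper_handlebodyChart_modelHandles_radialOde` of the model lemma M3.**  The last stage of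
the squeeze of part 2 of the data stub `helper_handlebodyChart_modelHandles_data` is the time-`T` map of the
flow of the cut-off radial field `-χ Ψ (z - z₀, 0)` towards the base centre `z₀ = -20k i` (`Ψ = Π_j ψ(|z - c_j|²)`
the stall cutoff of the holes, `χ` the cutoff to `D_k`).  Along an orbit the shadow offset `q = z - z₀`
solves the linear equation `q' = -b(t) q` with a continuous coefficient `0 ≤ b ≤ 1`; this file proves the two
tools of the orbit analysis:

* `ModelHandles.radial_ode` — for such `q` there is a continuous real `Λ`, `Λ(0) = 1`, `0 < Λ ≤ 1` and
  non-increasing on `[0, ∞)`, with `q(t) = Λ(t) q(0)` for `t ≥ 0` (the shadow moves monotonically along its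
  ray towards `z₀`), and `Λ(t₂) = Λ(t₁) e^{-(t₂ - t₁)}` across any interval on which `b = 1` (full speed);
  one-variable calculus: `Im(q \bar q₀)²` and `-(Re(q \bar q₀) e^t)²` are non-increasing;
* `ModelHandles.levelFun_le_of_ray` — the level `G_k` stays `≤ 193/200` along such orbits of points of
  `D_k ∩ {G_k ≤ 24/25} ∩ {|w| ≤ 1/10}` whose shadows keep squared distance `≥ 64/25` from the holes: inside
  `|z| ≤ R/2` the planar potential is `< 19/20` by the zone estimates of the regular-value analysis
  (`MMSW.potential_lt_of_annulus`, `MMSW.potential_lt_of_forall_le_dist`), outside the shadow is no farther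
  out than initially and the holes contribute `≤ 1/576`.

No definitions, no named facts, no `sorry`.  References: J. Milnor, *Morse Theory* (1963), §3 [Milnor1963].
-/

-- the prescribed namespace `Summit.<P>.<Sub>.…` duplicates `SmoothPoincare4` (P = Sub)
set_option linter.dupNamespace false
set_option linter.style.longLine false

noncomputable section

open scoped Manifold ContDiff Topology ComplexConjugate
open Function Set Metric Filter
open Literature.Topology.FourManifolds Literature.Topology.FourManifolds.MMSW
open Literature.AlgebraicTopology.Homotopy.HopfFibration

namespace Summit.SmoothPoincare4.SmoothPoincare4.Theorems.DcrGap.MkFriends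

namespace ModelHandles

/-! ## The linear equation of the shadow offset -/

/-- **Solutions of `q' = -b(t) q` with `0 ≤ b ≤ 1`** (see the module docstring): `q(t) = Λ(t) q(0)` for
`t ≥ 0` with `Λ` continuous, `Λ(0) = 1`, `0 < Λ ≤ 1`, non-increasing on `[0, ∞)`, and
`Λ(t₂) = Λ(t₁) e^{-(t₂ - t₁)}` whenever `b = 1` on `[t₁, t₂]`. [folklore] -/
theorem radial_ode {q : ℝ → ℂ} {b : ℝ → ℝ} (hq : ∀ t, HasDerivAt q (-(b t : ℂ) * q t) t)
    (hb0 : ∀ t, 0 ≤ b t) (hb1 : ∀ t, b t ≤ 1) :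
    ∃ Λ : ℝ → ℝ, Continuous Λ ∧ Λ 0 = 1 ∧ (∀ t, 0 ≤ t → 0 < Λ t ∧ Λ t ≤ 1) ∧ AntitoneOn Λ (Ici 0) ∧
      (∀ t, 0 ≤ t → q t = (Λ t : ℂ) * q 0) ∧
      ∀ t₁ t₂, 0 ≤ t₁ → t₁ ≤ t₂ → (∀ t ∈ Icc t₁ t₂, b t = 1) →
        Λ t₂ = Λ t₁ * Real.exp (-(t₂ - t₁)) := by
  have hexp_anti : AntitoneOn (fun t : ℝ => Real.exp (-t)) (Ici 0) := fun s _ t _ hst =>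
    Real.exp_le_exp.2 (by linarith)
  by_cases hq0 : q 0 = 0
  · -- the rest point: `|q|²` is non-increasing, so `q = 0` on `[0, ∞)`
    have hn : ∀ t, HasDerivAt (fun t => ‖q t‖ ^ 2) (-(2 * b t * ‖q t‖ ^ 2)) t := by
      intro t
      have h := (hq t).norm_sq
      have e : -(b t : ℂ) * q t = (-b t) • q t := by rw [Complex.real_smul]; push_cast; ring
      rw [e, real_inner_smul_right, real_inner_self_eq_norm_sq] at h
      exact h.congr_deriv (by ring)
    have hanti : Antitone fun t => ‖q t‖ ^ 2 :=
      antitone_of_deriv_nonpos (fun t => (hn t).differentiableAt) fun t => by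
        rw [(hn t).deriv]
        have := hb0 t
        nlinarith [sq_nonneg ‖q t‖]
    have hzero : ∀ t, 0 ≤ t → q t = 0 := by
      intro t ht
      have h := hanti ht
      simp only [hq0, norm_zero] at h
      have : ‖q t‖ ^ 2 = 0 := le_antisymm (by simpa using h) (sq_nonneg _)
      exact norm_eq_zero.1 (pow_eq_zero_iff two_ne_zero |>.1 this)
    refine ⟨fun t => Real.exp (-t), Real.continuous_exp.comp continuous_neg, by simp, fun t ht =>
      ⟨Real.exp_pos _, by rw [Real.exp_le_one_iff]; linarith⟩, hexp_anti, fun t ht => ?_,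
      fun t₁ t₂ _ _ _ => ?_⟩
    · rw [hzero t ht, hq0, mul_zero]
    · rw [← Real.exp_add]; ring_nf
  -- the moving point: `μ = Re(q \bar q₀)`, `ν = Im(q \bar q₀)`
  set q₀ : ℂ := q 0 with hq₀
  set μ : ℝ → ℝ := fun t => (q t * conj q₀).re with hμ
  set ν : ℝ → ℝ := fun t => (q t * conj q₀).im with hν
  have hprod : ∀ t, HasDerivAt (fun t => q t * conj q₀) (((-b t : ℝ) : ℂ) * (q t * conj q₀)) t := by
    intro t
    exact ((hq t).mul_const (conj q₀)).congr_deriv (by push_cast; ring)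
  have hμd : ∀ t, HasDerivAt μ (-b t * μ t) t := by
    intro t
    have h := (Complex.reCLM.hasFDerivAt).comp_hasDerivAt t (hprod t)
    simp only [Function.comp_def, Complex.reCLM_apply, Complex.re_ofReal_mul] at h
    exact h
  have hνd : ∀ t, HasDerivAt ν (-b t * ν t) t := by
    intro t
    have h := (Complex.imCLM.hasFDerivAt).comp_hasDerivAt t (hprod t)
    simp only [Function.comp_def, Complex.imCLM_apply, Complex.im_ofReal_mul] at h
    exact h
  have hμ0 : μ 0 = ‖q₀‖ ^ 2 := by
    simp only [hμ, ← hq₀, Complex.mul_conj, ← Complex.normSq_eq_norm_sq]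
    exact Complex.ofReal_re _
  have hν0 : ν 0 = 0 := by
    simp only [hν, ← hq₀, Complex.mul_conj]
    exact Complex.ofReal_im _
  have hq₀pos : 0 < ‖q₀‖ ^ 2 := by positivity
  -- `ν² ↓`, hence `ν = 0` on `[0, ∞)`
  have hν2 : ∀ t, HasDerivAt (fun t => ν t * ν t) (-(2 * b t * (ν t * ν t))) t := fun t =>
    ((hνd t).mul (hνd t)).congr_deriv (by ring)
  have hνanti : Antitone fun t => ν t * ν t :=
    antitone_of_deriv_nonpos (fun t => (hν2 t).differentiableAt) fun t => by
      rw [(hν2 t).deriv]; nlinarith [hb0 t, mul_self_nonneg (ν t)]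
  have hνzero : ∀ t, 0 ≤ t → ν t = 0 := fun t ht => by
    have h := hνanti ht
    simp only [hν0, mul_zero] at h
    exact mul_self_eq_zero.1 (le_antisymm h (mul_self_nonneg _))
  -- `(μ e^t)² ↑`, hence `μ > 0` on `[0, ∞)`
  set m : ℝ → ℝ := fun t => μ t * Real.exp t with hm
  have hmd : ∀ t, HasDerivAt m ((1 - b t) * m t) t := fun t =>
    ((hμd t).mul (Real.hasDerivAt_exp t)).congr_deriv (by simp only [hm]; ring)
  have hm2 : ∀ t, HasDerivAt (fun t => m t * m t) (2 * (1 - b t) * (m t * m t)) t := fun t =>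
    ((hmd t).mul (hmd t)).congr_deriv (by ring)
  have hmmono : Monotone fun t => m t * m t :=
    monotone_of_deriv_nonneg (fun t => (hm2 t).differentiableAt) fun t => by
      rw [(hm2 t).deriv]; nlinarith [hb1 t, mul_self_nonneg (m t)]
  have hμc : Continuous μ := continuous_iff_continuousAt.2 fun t => (hμd t).continuousAt
  have hμpos : ∀ t, 0 ≤ t → 0 < μ t := by
    intro t ht
    by_contra hle
    push Not at hle
    obtain ⟨s, hs, hs0⟩ : ∃ s ∈ Icc 0 t, μ s = 0 := by
      have h := intermediate_value_Icc' ht hμc.continuousOn (a := 0) (b := t)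
      exact h ⟨hle, by rw [hμ0]; positivity⟩
    have h1 : m 0 * m 0 ≤ m s * m s := hmmono hs.1
    have h2 : m s = 0 := by simp only [hm, hs0, zero_mul]
    have h3 : m 0 = ‖q₀‖ ^ 2 := by simp only [hm, hμ0, Real.exp_zero, mul_one]
    rw [h2, h3] at h1
    nlinarith
  -- `μ ↓` on `[0, ∞)`
  have hμanti : AntitoneOn μ (Ici 0) := by
    refine antitoneOn_of_deriv_nonpos (convex_Ici 0) hμc.continuousOn
      (fun t _ => (hμd t).differentiableAt.differentiableWithinAt) fun t ht => ?_
    rw [interior_Ici] at ht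
    rw [(hμd t).deriv]
    have := hμpos t (le_of_lt ht)
    nlinarith [hb0 t]
  -- the factor `Λ = μ/|q₀|²`
  set Λ : ℝ → ℝ := fun t => μ t / ‖q₀‖ ^ 2 with hΛ
  have hΛq : ∀ t, 0 ≤ t → q t = (Λ t : ℂ) * q₀ := by
    intro t ht
    have hc : conj q₀ ≠ 0 := by simpa using hq0
    have hqc : q t * conj q₀ = (μ t : ℂ) := Complex.ext (by simp [hμ]) (by simpa [hν] using hνzero t ht)
    have hn : ((‖q₀‖ : ℝ) : ℂ) ≠ 0 := by exact_mod_cast (norm_ne_zero_iff.2 hq0)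
    apply mul_right_cancel₀ hc
    rw [hqc, mul_assoc, Complex.mul_conj, Complex.normSq_eq_norm_sq, hΛ]
    push_cast
    field_simp
  refine ⟨Λ, hμc.div_const _, by simp only [hΛ, hμ0]; field_simp, fun t ht => ⟨?_, ?_⟩,
    fun s hs t ht hst => ?_, hΛq, fun t₁ t₂ ht₁ ht₁₂ hb => ?_⟩
  · exact div_pos (hμpos t ht) hq₀pos
  · rw [hΛ, div_le_one hq₀pos, ← hμ0]
    exact hμanti (mem_Ici.2 le_rfl) (mem_Ici.2 ht) ht
  · exact div_le_div_of_nonneg_right (hμanti hs ht hst) hq₀pos.le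
  · -- full speed on `[t₁, t₂]`: `μ e^t` is constant there
    have hcont : ContinuousOn m (Icc t₁ t₂) :=
      (hμc.mul Real.continuous_exp).continuousOn
    have hderiv : ∀ t ∈ Ico t₁ t₂, HasDerivWithinAt m 0 (Ici t) t := by
      intro t ht
      have h := hmd t
      rw [hb t ⟨ht.1, ht.2.le⟩, sub_self, zero_mul] at h
      exact h.hasDerivWithinAt
    have h := constant_of_has_deriv_right_zero hcont hderiv t₂ ⟨ht₁₂, le_rfl⟩
    simp only [hm] at h
    simp only [hΛ]
    rw [div_mul_eq_mul_div, div_left_inj' hq₀pos.ne']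
    have he : Real.exp t₁ = Real.exp (-(t₂ - t₁)) * Real.exp t₂ := by
      rw [← Real.exp_add]; ring_nf
    exact mul_right_cancel₀ (Real.exp_pos t₂).ne' (by rw [h, he]; ring)

/-! ## The level function along the rays towards the base centre -/

/-- `(y₂)² + (y₃)² = |w|²`. [folklore] -/
theorem sq_add_sq_eq_norm_wC_sq (y : EuclideanSpace ℝ (Fin 4)) : (y 2) ^ 2 + (y 3) ^ 2 = ‖wC y‖ ^ 2 := by
  rw [Complex.sq_norm, Complex.normSq_apply]; simp [wC, sq]

/-- **`G_k ≤ 193/200` along the rays towards the base centre** (see the module docstring): if the shadow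
of `y` lies on the segment from `z₀ = -20k i` to the shadow of a point `x` of `{G_k ≤ 24/25}`,
`w(y) = w(x)` has norm `≤ 1/10`, and every hole is at squared distance `≥ 64/25` from the shadow
of `y`, then `G_k(y) ≤ 193/200`. [folklore] -/
theorem levelFun_le_of_ray (k : ℕ) {x y : EuclideanSpace ℝ (Fin 4)} {Λ : ℝ}
    (hGx : levelFun k x ≤ 24 / 25)
    (hw : wC y = wC x) (hwx : ‖wC x‖ ≤ 1 / 10)
    (hfar : ∀ j, (64 : ℝ) / 25 ≤ holeTerm k j y) (hΛ0 : 0 ≤ Λ) (hΛ1 : Λ ≤ 1)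
    (hray : zC y - Complex.mk 0 (-(20 * (k : ℝ))) = (Λ : ℂ) * (zC x - Complex.mk 0 (-(20 * (k : ℝ))))) :
    levelFun k y ≤ 193 / 200 := by
  set R : ℝ := 40 * ((k : ℝ) + 1) with hR
  set Z : ℂ := zC y with hZ
  set z₀ : ℂ := Complex.mk 0 (-(20 * (k : ℝ))) with hz₀
  have hk : (0 : ℝ) ≤ k := k.cast_nonneg
  have hplanar := levelFun_sub_normSq_w (r := k) y
  have hwy : (y 2) ^ 2 + (y 3) ^ 2 ≤ 1 / 100 := by
    rw [sq_add_sq_eq_norm_wC_sq, hw]; nlinarith [norm_nonneg (wC x)]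
  have hdist : ∀ j : Fin k, 8 / 5 ≤ ‖Z - holeCentre k j‖ := fun j => by
    have h := hfar j
    rw [holeTerm_eq_normSq, Complex.normSq_eq_norm_sq] at h
    nlinarith [norm_nonneg (zC y - holeCentre k j)]
  by_cases h2 : ‖Z‖ ≤ R / 2
  · -- inside `|z| ≤ R/2`: the zone estimates
    have hpot : Complex.normSq Z / R ^ 2 + ∑ j : Fin k, (Complex.normSq (Z - holeCentre k j))⁻¹ < 19 / 20 := by
      by_cases h8 : R / 8 ≤ ‖Z‖
      · exact potential_lt_of_annulus Z h8 h2
      · exact potential_lt_of_forall_le_dist Z (le_of_not_ge h8) fun j => by linarith [hdist j]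
    rw [← hR] at hplanar
    linarith
  · -- outside: no farther out than initially, holes far away
    push Not at h2
    have hz₀n : ‖z₀‖ = 20 * k := by
      simp only [hz₀, Complex.norm_eq_sqrt_sq_add_sq]
      rw [show (0 : ℝ) ^ 2 + (-(20 * (k : ℝ))) ^ 2 = (20 * k) ^ 2 by ring, Real.sqrt_sq (by positivity)]
    have hconv : ‖Z‖ ≤ (1 - Λ) * ‖z₀‖ + Λ * ‖zC x‖ := by
      have e : Z = (((1 - Λ : ℝ)) : ℂ) * z₀ + (Λ : ℂ) * zC x := by
        have : Z = z₀ + (Λ : ℂ) * (zC x - z₀) := by rw [← hray]; ring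
        rw [this]; push_cast; ring
      calc ‖Z‖ = ‖(((1 - Λ : ℝ)) : ℂ) * z₀ + (Λ : ℂ) * zC x‖ := by rw [← e]
        _ ≤ ‖(((1 - Λ : ℝ)) : ℂ) * z₀‖ + ‖(Λ : ℂ) * zC x‖ := norm_add_le _ _
        _ = (1 - Λ) * ‖z₀‖ + Λ * ‖zC x‖ := by
          rw [norm_mul, norm_mul, Complex.norm_real, Complex.norm_real, Real.norm_of_nonneg (by linarith),
            Real.norm_of_nonneg hΛ0]
    rw [hz₀n] at hconv
    have hZx : ‖Z‖ ≤ ‖zC x‖ := by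
      by_contra hlt
      push Not at hlt
      have hR2 : 20 * (k : ℝ) < ‖Z‖ := by rw [hR] at h2; linarith
      rcases hΛ0.eq_or_lt with h | h
      · rw [← h] at hconv; linarith
      · nlinarith [mul_lt_mul_of_pos_left hlt h,
          mul_le_mul_of_nonneg_left hR2.le (by linarith : (0 : ℝ) ≤ 1 - Λ)]
    -- the confinement term
    have hconf : Complex.normSq Z / R ^ 2 ≤ Complex.normSq (zC x) / R ^ 2 := by
      rw [Complex.normSq_eq_norm_sq, Complex.normSq_eq_norm_sq]
      gcongr
    -- the holes
    have hhole : ∀ j : Fin k, (Complex.normSq (Z - holeCentre k j))⁻¹ ≤ ((16 * (k : ℝ) + 20) ^ 2)⁻¹ := by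
      intro j
      have h1 : 16 * (k : ℝ) + 20 ≤ ‖Z - holeCentre k j‖ := by
        have := norm_sub_norm_le Z (holeCentre k j)
        have := norm_holeCentre_le j
        rw [hR] at h2; linarith
      rw [Complex.normSq_eq_norm_sq]
      exact inv_anti₀ (by positivity) (pow_le_pow_left₀ (by positivity) h1 2)
    have hsum : ∑ j : Fin k, (Complex.normSq (Z - holeCentre k j))⁻¹ ≤ 1 / 576 := by
      refine (Finset.sum_le_sum fun j _ => hhole j).trans ?_
      rw [Finset.sum_const, Finset.card_univ, Fintype.card_fin, nsmul_eq_mul]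
      have hpos : (0 : ℝ) < (16 * (k : ℝ) + 20) ^ 2 := by positivity
      rw [← div_eq_mul_inv, div_le_div_iff₀ hpos (by norm_num : (0 : ℝ) < 576)]
      nlinarith
    -- compare with `G_k x`
    have hplanarx := levelFun_sub_normSq_w (r := k) x
    have hHx : 0 ≤ ∑ j : Fin k, (Complex.normSq (zC x - holeCentre k j))⁻¹ :=
      Finset.sum_nonneg fun j _ => inv_nonneg.2 (Complex.normSq_nonneg _)
    have hwxy : (y 2) ^ 2 + (y 3) ^ 2 = (x 2) ^ 2 + (x 3) ^ 2 := by
      rw [sq_add_sq_eq_norm_wC_sq, sq_add_sq_eq_norm_wC_sq, hw]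
    rw [← hR] at hplanar hplanarx
    linarith

end ModelHandles

/-- **Registered piece `helper_handlebodyChart_modelHandles_radialOde` of the model lemma M3 (the linear
equation of the shadow offset along the cut-off radial flow)**: solutions of `q' = -b(t) q` with
`0 ≤ b ≤ 1` are `q(t) = Λ(t) q(0)` on `[0, ∞)` with `Λ` continuous, `Λ(0) = 1`, `0 < Λ ≤ 1`, non-increasing,
and decaying exactly like `e^{-t}` across intervals of full speed (`ModelHandles.radial_ode`). [folklore] -/
theorem helper_handlebodyChart_modelHandles_radialOde : ∀ (q : ℝ → ℂ) (b : ℝ → ℝ), (∀ t, HasDerivAt q (-(b t : ℂ) * q t) t) → (∀ t, 0 ≤ b t) → (∀ t, b t ≤ 1) → ∃ Λ : ℝ → ℝ, Continuous Λ ∧ Λ 0 = 1 ∧ (∀ t : ℝ, 0 ≤ t → 0 < Λ t ∧ Λ t ≤ 1) ∧ AntitoneOn Λ (Set.Ici 0) ∧ (∀ t : ℝ, 0 ≤ t → q t = (Λ t : ℂ) * q 0) ∧ ∀ t₁ t₂ : ℝ, 0 ≤ t₁ → t₁ ≤ t₂ → (∀ t ∈ Set.Icc t₁ t₂, b t = 1)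 → Λ t₂ = Λ t₁ * Real.exp (-(t₂ - t₁)) :=
  fun _ _ hq hb0 hb1 => ModelHandles.radial_ode hq hb0 hb1

end Summit.SmoothPoincare4.SmoothPoincare4.Theorems.DcrGap.MkFriends

end
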